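import Literature.AlgebraicGeometry.ModuliOfAbelianVarieties.SiegelReciprocityContinuous
import Literature.AlgebraicGeometry.ModuliOfAbelianVarieties.SiegelReciprocityPrincipalIdele
import Literature.NumberTheory.NumberFields.FiniteIdeleCongruenceSubgroupBasis
import HarnessLib

/-!
# The reciprocity law (62) has a conductor: its right-hand side factors through a ray class group of `E`

Topic `AlgebraicGeometry/ModuliOfAbelianVarieties`; namespace `Literature.AlgebraicGeometry.ModuliOfAbelianVarieties.CMStructure`.
THEOREMS ONLY (no definition, no named fact, no instance, no `sorry`).  Cell hodgecm-mathlib, road #60 (`SiegelS1`),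
sequel R60-39b of ★ R60-39 `SiegelReciprocityContinuous` (the open subgroup `U_{a,N} = r⁻¹(a K_δ(N) a⁻¹) ⊆ 𝔸_{E,f}^×`) and
★ R60-26 `SiegelReciprocityPrincipalIdele` (principal idèles are invisible): by Neukirch's (1.8) — the congruence subgroups
`I^𝔪_f = {u | ord_v u = 0, u_v ≡ 1 (mod 𝔪)}` (★ `IdeleAction.congruenceUnits`) form a basis of neighbourhoods of `1` in
`𝔸_{E,f}^×` (★ `IdeleAction.exists_congruenceUnits_subset_of_mem_nhds`) — `U_{a,N}` CONTAINS some `I^𝔪_f`, `𝔪 ≠ 0`.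
Consequently the right-hand side `[J, r(s)·aK_δ(N)]` of the typed reciprocity law ★ `SiegelRationalModel.IsCanonical` at the
point `[J, a]` and the principal level `K_δ(N)` is constant on the cosets `E^× · s · I^𝔪_f`: it is a function on the RAY CLASS
GROUP `E^×∖𝔸_{E,f}^×/I^𝔪_f` — the shape through which `σ ↦ art_E(s)|` is read on a finite abelian layer
([Deligne1971TravauxShimura] 3.9–3.10: the reciprocity morphism of a torus is continuous and trivial on `E^×`;
[Milne2005ShimuraVarieties] (59)–(62)).

## References
* [Deligne1971TravauxShimura] P. Deligne, *Travaux de Shimura* (1971), 3.9–3.10 p. 140, Déf. 3.13 p. 141, 4.18 p. 150.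
* [Milne2005ShimuraVarieties] J. S. Milne, *Introduction to Shimura varieties* (2005), Def. 12.8 (59)–(62) p. 114.
* [NeukirchANT1999] J. Neukirch, *Algebraic Number Theory* (1999), Ch. VI §1 Def. (1.7), Prop. (1.8) pp. 363–364.
-/

set_option autoImplicit false

noncomputable section

open Matrix NumberField IsDedekindDomain Topology

namespace Literature.AlgebraicGeometry.ModuliOfAbelianVarieties

open Literature.NumberTheory.ComplexMultiplication (traceField)
open Literature.NumberTheory.NumberFields (IdeleAction.congruenceUnits IdeleAction.exists_congruenceUnits_subset_of_mem_nhds)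

namespace CMStructure

variable {g : ℕ} {δ : Fin g → ℕ} {ι : Type} [Fintype ι] [DecidableEq ι] {K : ι → Type} [∀ i, Field (K i)]
  [∀ i, NumberField (K i)] [∀ i, IsCMField (K i)] (c : CMStructure g δ ι K)
  (Φ : ∀ i, Motives.CMType (K i)) (E : IntermediateField ℚ ℂ) [NumberField ↥E]

/-- **`U_{a,N}` contains a congruence subgroup**: for every `a ∈ GSp_δ(𝔸_f)` and `N ≥ 1` there is an ideal `𝔪 ≠ 0` of
`𝓞_E` such that the reciprocity element of every `u ∈ I^𝔪_f` lies in `a K_δ(N) a⁻¹` (★ R60-39 `…_mem_nhds` + ★ Neukirch (1.8)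
`IdeleAction.exists_congruenceUnits_subset_of_mem_nhds`). [cite: NeukirchANT1999, Ch. VI §1 Prop. (1.8) pp. 363–364]
[cite: Deligne1971TravauxShimura, 3.9–3.10 p. 140] -/
theorem exists_congruenceUnits_subset_setOf_exists_mem_principalLevelSubgroup_conj_eq {N : ℕ} (hN : N ≠ 0)
    (hE : ∀ i, traceField (Φ i) ≤ E) (a : gspFinAdelic δ) :
    ∃ 𝔪 : Ideal (𝓞 ↥E), 𝔪 ≠ ⊥ ∧ ∀ u ∈ IdeleAction.congruenceUnits (K := ↥E) 𝔪,
      ∃ k ∈ principalLevelSubgroup δ N,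
        (((a * k * a⁻¹ : gspFinAdelic δ) : GL (Fin g ⊕ Fin g) finAdeleQ) :
          Matrix (Fin g ⊕ Fin g) (Fin g ⊕ Fin g) finAdeleQ) = c.cmRecipMatrix Φ E u := by
  obtain ⟨𝔪, h𝔪, hsub⟩ := IdeleAction.exists_congruenceUnits_subset_of_mem_nhds
    (c.setOf_exists_mem_principalLevelSubgroup_conj_eq_mem_nhds Φ E hN hE a)
  exact ⟨𝔪, h𝔪, fun u hu => hsub hu⟩

/-- **(62) has a CONDUCTOR**: there is `𝔪 ≠ 0` such that `[J, r(s·u)·aK_δ(N)] = [J, r(s)·aK_δ(N)]` for every finite idèle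
`s` of `E` and every `u ∈ I^𝔪_f` (reciprocity elements `r_s`, `r_{su}` in the binder shape of ★ `IsCanonical`).
[cite: Deligne1971TravauxShimura, 3.9–3.10 p. 140, Déf. 3.13 p. 141] [cite: Milne2005ShimuraVarieties, Def. 12.8 (62) p. 114]
[cite: NeukirchANT1999, Ch. VI §1 Prop. (1.8) pp. 363–364] -/
theorem exists_conductor_mk_cmRecip_mul_eq {N : ℕ} (hN : N ≠ 0) (hE : ∀ i, traceField (Φ i) ≤ E)
    (a : gspFinAdelic δ) :
    ∃ 𝔪 : Ideal (𝓞 ↥E), 𝔪 ≠ ⊥ ∧ ∀ (s u : (FiniteAdeleRing (𝓞 ↥E) ↥E)ˣ),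
      u ∈ IdeleAction.congruenceUnits (K := ↥E) 𝔪 →
        ∀ (rs rsu : gspFinAdelic δ),
          ((rs : GL (Fin g ⊕ Fin g) finAdeleQ) : Matrix (Fin g ⊕ Fin g) (Fin g ⊕ Fin g) finAdeleQ) =
              c.cmRecipMatrix Φ E s →
          ((rsu : GL (Fin g ⊕ Fin g) finAdeleQ) : Matrix (Fin g ⊕ Fin g) (Fin g ⊕ Fin g) finAdeleQ) =
              c.cmRecipMatrix Φ E (s * u) →
          ∀ J : C0pm δ,
            SiegelShimuraSet.mk δ (principalLevelSubgroup δ N) J (rsu * a) =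
              SiegelShimuraSet.mk δ (principalLevelSubgroup δ N) J (rs * a) := by
  obtain ⟨𝔪, h𝔪, h⟩ := c.exists_congruenceUnits_subset_setOf_exists_mem_principalLevelSubgroup_conj_eq Φ E hN hE a
  exact ⟨𝔪, h𝔪, fun s u hu rs rsu hrs hrsu J =>
    SiegelShimuraSet.mk_cmRecip_mul_mul_eq c Φ E a (h u hu) rs rsu hrs hrsu J⟩

/-- **(62) factors through the ray class group `E^×∖𝔸_{E,f}^×/I^𝔪_f`**: with the conductor `𝔪` of the previous theorem,
the right-hand side `[J, r(s)·aK_δ(N)]` is unchanged under `s ↦ e·s·u` for `e ∈ E^×` (★ R60-26: the reciprocity element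
of a principal idèle is a rational torus element fixing `J`) and `u ∈ I^𝔪_f` — for a special pair `(c, J, Φ)`.
[cite: Deligne1971TravauxShimura, 3.9–3.10 p. 140, Déf. 3.13 p. 141, 4.18 p. 150] [cite: Milne2005ShimuraVarieties, Def. 12.8 (59)–(62) p. 114]
[cite: NeukirchANT1999, Ch. VI §1 Prop. (1.8) pp. 363–364] -/
theorem exists_conductor_mk_cmRecip_unitEmbedding_mul_mul_eq {N : ℕ} (hN : N ≠ 0) {J : C0pm δ} (hJ : c.IsSpecial J Φ)
    (hE : ∀ i, traceField (Φ i) ≤ E) (a : gspFinAdelic δ) :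
    ∃ 𝔪 : Ideal (𝓞 ↥E), 𝔪 ≠ ⊥ ∧ ∀ (e : (↥E)ˣ) (s u : (FiniteAdeleRing (𝓞 ↥E) ↥E)ˣ),
      u ∈ IdeleAction.congruenceUnits (K := ↥E) 𝔪 →
        ∀ (rs r' : gspFinAdelic δ),
          ((rs : GL (Fin g ⊕ Fin g) finAdeleQ) : Matrix (Fin g ⊕ Fin g) (Fin g ⊕ Fin g) finAdeleQ) =
              c.cmRecipMatrix Φ E s →
          ((r' : GL (Fin g ⊕ Fin g) finAdeleQ) : Matrix (Fin g ⊕ Fin g) (Fin g ⊕ Fin g) finAdeleQ) =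
              c.cmRecipMatrix Φ E (FiniteAdeleRing.unitEmbedding (𝓞 ↥E) ↥E e * s * u) →
          SiegelShimuraSet.mk δ (principalLevelSubgroup δ N) J (r' * a) =
            SiegelShimuraSet.mk δ (principalLevelSubgroup δ N) J (rs * a) := by
  obtain ⟨𝔪, h𝔪, h⟩ := c.exists_congruenceUnits_subset_setOf_exists_mem_principalLevelSubgroup_conj_eq Φ E hN hE a
  refine ⟨𝔪, h𝔪, fun e s u hu rs r' hrs hr' => ?_⟩
  -- the reciprocity elements of `e` and of `s·u`
  obtain ⟨re, hre⟩ := c.exists_gspFinAdelic_coe_eq_cmRecipMatrix' Φ E hE (FiniteAdeleRing.unitEmbedding (𝓞 ↥E) ↥E e)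
  obtain ⟨rsu, hrsu⟩ := c.exists_gspFinAdelic_coe_eq_cmRecipMatrix' Φ E hE (s * u)
  have hr'eq : r' = re * rsu := by
    apply Subtype.ext
    apply Units.ext
    rw [hr', mul_assoc, c.cmRecipMatrix_mul, Subgroup.coe_mul, Units.val_mul, hre, hrsu]
  rw [hr'eq, mul_assoc, SiegelShimuraSet.mk_cmRecip_unitEmbedding_mul c Φ E hJ hE e re hre _ (rsu * a)]
  exact SiegelShimuraSet.mk_cmRecip_mul_mul_eq c Φ E a (h u hu) rs rsu hrs hrsu J

end CMStructure

end Literature.AlgebraicGeometry.ModuliOfAbelianVarieties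

end
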